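import Mathlib

/-!
# Sketch — crux-ideate stmt-PneNP-9816 (ResolutionUncertainty), ideator 3, round 1

First-lemma signatures for the idea cards
* `Ideas/structured-live-box-walk.md`  → `BoxCoverOneAxis`, `CliqueExtensionFamily`
* `Ideas/falsification-entropy-width.md` → `EntropySizeWidth`, `HereditaryBiDensity`

Everything is stated over Mathlib only (`SimpleGraph.CliqueFree`, `Nat.clog`, `SimpleGraph.IsClique`,
`Real.logb`, `Finset`); the unary clique CNF of the crux is the one-hot encoding of the CSP on
`Fin k → Fin n` used below (blocks = indices, values = vertices), cf. the route decl
`Summit.PneNP.PneNP.Theses.RamseyUncertifiable.ResolutionUncertainty`.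
-/

namespace Summit.PneNP.PneNP.Cruxes.ResolutionUncertainty.Sketch

open Finset

/-- 2-Ramsey at the route's exact threshold `k = Nat.clog 2 (n^2) = ⌈2 log₂ n⌉`. -/
def IsTwoRamsey {n : ℕ} (G : SimpleGraph (Fin n)) : Prop :=
  G.CliqueFree (Nat.clog 2 (n ^ 2)) ∧ Gᶜ.CliqueFree (Nat.clog 2 (n ^ 2))

/-! ## Boxes in `V^k` (the semantic lines of unary / signed resolution) -/

/-- A box `B : Fin k → Finset (Fin n)` as a set of tuples. -/
def boxSet {k n : ℕ} (B : Fin k → Finset (Fin n)) : Set (Fin k → Fin n) :=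
  {y | ∀ i, y i ∈ B i}

/-- Falsification entropy ("entropy width") of the signed clause whose falsifying box is `B`:
`ew(B) = Σ_i log₂ (n / |B i|) = -log₂ Pr_{y uniform in V^k}[y ∈ B]`.  For `n = 2` this is the
ordinary width of a Boolean clause. (An empty coordinate gives `logb 2 (n/0) = 0` in Mathlib's
junk convention; refutation lines below are required to have nonempty coordinates.) -/
noncomputable def ew {k n : ℕ} (B : Fin k → Finset (Fin n)) : ℝ :=
  ∑ i, Real.logb 2 ((n : ℝ) / ((B i).card : ℝ))

/-- Semantic box refutation of an axiom family `𝒜` (each axiom given by its falsifying box):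
a list of boxes, each an axiom box or covered pointwise by two earlier boxes, ending with the
full box `V^k` (the empty clause). Its length is the size of the refutation. Unary resolution
refutations of the crux's CNF map line-by-line into this model (one-hot semantics). -/
def IsBoxRefutation {k n : ℕ} (𝒜 : Set (Fin k → Finset (Fin n)))
    (π : List (Fin k → Finset (Fin n))) : Prop :=
  (∀ t : Fin π.length, (∀ i, (π.get t i).Nonempty) ∧
      (π.get t ∈ 𝒜 ∨ ∃ s s' : Fin π.length, s.1 < t.1 ∧ s'.1 < t.1 ∧
        boxSet (π.get t) ⊆ boxSet (π.get s) ∪ boxSet (π.get s'))) ∧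
  ∃ h : 0 < π.length, π.get ⟨π.length - 1, by omega⟩ = fun _ => Finset.univ

/-- **Card `structured-live-box-walk`, First lemma (a).** Box covering happens along ONE axis:
if a box with nonempty sides is covered by two boxes then either it lies in one of them, or there
is a unique axis `i` outside which it lies in both — i.e. semantic signed resolution = syntactic
signed resolution (resolve on block `i`). Provable now; it is step (i) of the walk. -/
def BoxCoverOneAxis : Prop :=
  ∀ (k n : ℕ) (L B₁ B₂ : Fin k → Finset (Fin n)),
    (∀ i, (L i).Nonempty) →
    boxSet L ⊆ boxSet B₁ ∪ boxSet B₂ →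
      (∀ i, L i ⊆ B₁ i) ∨ (∀ i, L i ⊆ B₂ i) ∨
      ∃ i, L i ⊆ B₁ i ∪ B₂ i ∧ ∀ j, j ≠ i → L j ⊆ B₁ j ∩ B₂ j

/-- **Card `structured-live-box-walk`, First lemma (b).** The pin-game adversary's resource in a
2-Ramsey graph: a nonempty, downward-closed family of cliques in which every member of size
`≤ c log₂ n` has at least `√n` one-vertex extensions inside the family (LPRT Lemma 13 with full
pins instead of bit patterns: Prömel–Rödl core + LPRT Cor. 12; size M, needs Prömel–Rödl). -/
def CliqueExtensionFamily : Prop :=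
  ∃ c : ℝ, 0 < c ∧ ∃ n₀ : ℕ, ∀ n ≥ n₀,
    ∀ (G : SimpleGraph (Fin n)) [DecidableRel G.Adj], IsTwoRamsey G →
      ∃ 𝓕 : Finset (Finset (Fin n)), ∅ ∈ 𝓕 ∧
        (∀ U ∈ 𝓕, G.IsClique (U : Set (Fin n))) ∧
        (∀ U ∈ 𝓕, ∀ W, W ⊆ U → W ∈ 𝓕) ∧
        ∀ U ∈ 𝓕, (U.card : ℝ) ≤ c * Real.logb 2 n →
          (n : ℝ) ^ (1 / 2 : ℝ) ≤
            ((Finset.univ.filter fun v : Fin n => v ∉ U ∧ insert v U ∈ 𝓕).card : ℝ)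

/-- **Card `falsification-entropy-width`, First lemma (the lever itself, graph-free).**
Entropy size–width relation for semantic box (= signed / multi-valued) resolution over `V^k`:
a refutation of size `S` from axioms of entropy `≤ w₀` can be rebuilt with every line of entropy
`≤ w₀ + C √(k log₂ n · log₂ S)`.  For `n = 2` this is Ben-Sasson–Wigderson (`#vars = k`); the
bet is that total entropy `k log₂ n` replaces the number of variables in general. -/
def EntropySizeWidth : Prop :=
  ∃ C : ℝ, 0 < C ∧ ∀ (k n : ℕ), 2 ≤ n →
    ∀ (𝒜 : Set (Fin k → Finset (Fin n))) (w₀ : ℝ), (∀ A ∈ 𝒜, ew A ≤ w₀) →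
      ∀ π : List (Fin k → Finset (Fin n)), IsBoxRefutation 𝒜 π →
        ∃ π' : List (Fin k → Finset (Fin n)), IsBoxRefutation 𝒜 π' ∧
          ∀ B ∈ π', ew B ≤ w₀ + C * Real.sqrt (k * Real.logb 2 n * Real.logb 2 π.length)

/-- **Card `falsification-entropy-width`, supporting lemma.** Hereditary bi-density of 2-Ramsey
graphs at every polynomial scale (Erdős–Szemerédi 1972 applied to `G[A]` and `Ḡ[A]`): the
statistic the entropy-budget adversary needs for ALL `n^{1-ε}`-subsets, since against set-valued
memory hiding in a sublinear Prömel–Rödl core is free for the Prover. Known in print; size M. -/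
def HereditaryBiDensity : Prop :=
  ∀ ε : ℝ, 0 < ε → ε < 1 → ∃ δ : ℝ, 0 < δ ∧ ∃ n₀ : ℕ, ∀ n ≥ n₀,
    ∀ (G : SimpleGraph (Fin n)) [DecidableRel G.Adj], IsTwoRamsey G →
      ∀ A : Finset (Fin n), (n : ℝ) ^ (1 - ε) ≤ (A.card : ℝ) →
        δ * (A.card : ℝ) ^ 2 ≤ (((A ×ˢ A).filter fun p => G.Adj p.1 p.2).card : ℝ) ∧
        (((A ×ˢ A).filter fun p => G.Adj p.1 p.2).card : ℝ) ≤ (1 - δ) * (A.card : ℝ) ^ 2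

/-- Sanity: the four Props elaborate. -/
example : Prop := BoxCoverOneAxis ∧ CliqueExtensionFamily ∧ EntropySizeWidth ∧ HereditaryBiDensity

end Summit.PneNP.PneNP.Cruxes.ResolutionUncertainty.Sketch
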